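import Summits.QuantumFields.BalabanUV.Beta.D1BFx.FineHessianWard
import Summits.QuantumFields.BalabanUV.Beta.AxialDressingRootedBridge

/-!
# `BalabanUV.Beta.D1BFx.CoProjDivergence` — THE PURE-GAUGE VERTEX OF A `Πᵀ`-DRESSED STENCIL FAMILY: `cod (coProj L g)` and
# `KernelWard.divV (coProj N S)` are SUPPORTED ON THE BASE POINTS and equal the BLOCK SUM of the undressed divergences there
# (the transpose of `AxialProjector.axProj_grad`; road «FP» ∕ «BF-x» for binder row D1, sub-leaf N3-fine-REL, part 1 of 3)

HONEST DEPENDENCY (page 1, mandatory): continuum YM on T⁴ ⇐ BetaPertH ∧ nine spine estimates (0/9 proved); BetaPertH ⇐ (D1) ∧ (D4) ∧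
CAP+tail; G-an2-4 gates asym, D1 and NE2/3/4.  HONEST FRAMING (cell contract, verbatim): «discharging `BetaPertH` makes Bałaban's UV
stability UNCONDITIONAL — a real constructive-QFT result; it is NOT the continuum limit and NOT the Clay problem.»  No definition, no
`def … : Prop`, nothing cited; pure lattice combinatorics over an2's `AxialProjector` ∕ `AxialDressingRooted` BY NAME ([folklore]
throughout); 0 binders of row D1 touched; NOT D1, NOT BetaPertH, NOT continuum, NOT Clay.  ABSOLUTE RULE (cell charter, verbatim): «No
internally-minted statement may enter as a cited fact. Every hypothesis is either kernel-proved in this package or a verbatim quotation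
of a PUBLISHED theorem with page reference. The manuscript(s) under audit are NOT citable for their own disputed steps — they are the
thing under adjudication; programme-internal (2001/route/tribunal) claims are never citable.»

WHY.  The Ward input of road FP's REP∞ chain (`hrow` of `FP/PerfectFullSandwich` ∕ `FP/RepSeam`; and, after leaf-02's Kronecker–Ward
route, `hT1` too) is first-bond divergence-freeness of the DRESSED fine kernel `fineHessA (axDressK n K) (coProj n S) Wf`, whose
first-order vertex is the `Πᵀ`-dressed stencil family `coProj n S`.  Its pure-gauge vertex `divV (coProj n S) u` is NOT a fine-site
object: since `Π (grad f) = grad (f ∘ base)` (`axProj_grad` — the axial projector kills the residual pure gauges and passes the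
block-constant ones), the transpose sends the point divergence to the BLOCK divergence read at the base point.  Parts 2–3
(`D1BFx/FineHessianWardRelative`, `FP/PerfectFineWard`) feed this into an1's relative-inverse Ward identity.

CONTENT.
* [folklore] `mem_nbhd_of_le_succ`, `near_mem_nbhd` (membership in an2's block-closed neighbourhood `AxialDressingRooted.nbhd`).
* [folklore] **`cod_coProj`**: for every real bond family `g` (no support ∕ size hypothesis), `1 ≤ L`:
  `cod (coProj L g) p = [L•blk L p = p] · Σ_{c ∈ box} cod g (p + c)` — truncation to `nbhd L p` (`coProj_congr_local`), the adjunction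
  `sum_coProj_mul` against `grad δ_p`, `axProj_grad`, summation by parts `sum_mul_grad_eq`, `image_box_eq_filter`.
* [folklore] `unitVec_eq` (the two unit-vector letters of the tree agree), `coProj_eval'` (any fibre), `divV_apply_eq_cod`, and
  **`divV_coProj`**: `KernelWard.divV (coProj N S) u = [N•blk N u = u] · Σ_{c∈box} KernelWard.divV S (u + c)` for `MKer`-valued
  families over ANY fibre and dimension; `divW_eq_divV_fst`, **`divW_coProj_fst`** (the same for a bi-table dressed by `Πᵀ` in its first
  bond slot — so a BLOCK second-order Ward law is the natural supplier of (W2♮) against a base-point-supported generator).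
NOT HERE: the ROOTED transpose `AxialDressingRooted.coProjAt ρ` (this is the corner-rooted `coProj` of `AxialDressing`, the literal of
road FP's binder; `coProjAt_zero_eq_coProj` relates them at `ρ = 0`).  Unit `b2b-balaban-beta-d1-formalise-leaf-01` (gen 5), 2026-08-20.
-/

noncomputable section

namespace Summit.QuantumFields.BalabanUV.Beta.D1BFx.CoProjDivergence

open Finset
open scoped BigOperators
open Literature.MathematicalPhysics.QuantumFieldTheory.Balaban1983to89
open Literature.MathematicalPhysics.QuantumFieldTheory.Balaban1983to89.Beta
open AffineAveraging (Form0 Form1 box toSite)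
open AveragingContours (blk off off_mem_box blk_block blk_add_off grad)
open AxialProjector (axProj coProj coProj_apply cod BlockClosed sum_coProj_mul sum_mul_grad_eq axProj_grad coProj_congr_local
  image_box_eq_filter blk_zsmul zsmul_blk_le lt_zsmul_blk_add toSite_injective)
open Summit.QuantumFields.BalabanUV.Beta.AxialDressingRooted (nbhd mem_nbhd nbhd_blockClosed mem_nbhd_of_abs_sub_le)

/-! ## §1 The fine divergence of a `Πᵀ`-dressed bond family: supported on base points, block sum there -/

section CodCoProj

variable {d : ℕ}

/-- [folklore] Sites within `L + 1` of `p` in every coordinate lie in an2's block-closed neighbourhood `nbhd L p` (`1 ≤ L`). -/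
theorem mem_nbhd_of_le_succ {L : ℕ} (hL : 1 ≤ L) {p z : Fin d → ℤ} (h : ∀ i, |z i - p i| ≤ (L : ℤ) + 1) : z ∈ nbhd L p := by
  refine mem_nbhd_of_abs_sub_le hL fun i => (h i).trans ?_
  have hL1 : (1 : ℤ) ≤ L := by exact_mod_cast hL
  linarith

/-- [folklore] Bonds read by `Πᵀ` at a site next to `p` lie, with their heads, in `nbhd L p`. -/
theorem near_mem_nbhd {L : ℕ} (hL : 1 ≤ L) {p q z : Fin d → ℤ} {κ : Fin d} (hq : ∀ i, |q i - p i| ≤ 1)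
    (hz : blk L z = blk L q ∨ blk L (z + AffineAveraging.unitVec κ) = blk L q) :
    z ∈ nbhd L p ∧ z + AffineAveraging.unitVec κ ∈ nbhd L p := by
  have key : ∀ i, |z i - p i| ≤ (L : ℤ) + 1 ∧ |(z + AffineAveraging.unitVec κ) i - p i| ≤ (L : ℤ) + 1 := by
    intro i
    have a1 := zsmul_blk_le hL q i
    have a2 := lt_zsmul_blk_add hL q i
    have c1 := abs_le.1 (hq i)
    have e : (z + AffineAveraging.unitVec κ) i = z i + (if i = κ then 1 else 0) := by
      simp only [Pi.add_apply, AffineAveraging.unitVec, Pi.single_apply]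
    rw [e, abs_le, abs_le]
    rcases hz with h | h
    · have b1 := zsmul_blk_le hL z i
      have b2 := lt_zsmul_blk_add hL z i
      rw [h] at b1 b2
      split_ifs <;> omega
    · have b1 := zsmul_blk_le hL (z + AffineAveraging.unitVec κ) i
      have b2 := lt_zsmul_blk_add hL (z + AffineAveraging.unitVec κ) i
      rw [h, e] at b1 b2
      split_ifs at b1 b2 ⊢ <;> omega
  exact ⟨mem_nbhd_of_le_succ hL fun i => (key i).1, mem_nbhd_of_le_succ hL fun i => (key i).2⟩

/-- [folklore] **THE TRANSPOSE OF `axProj_grad`: THE FINE DIVERGENCE OF A `Πᵀ`-DRESSED BOND FAMILY.**  For every real bond family `g`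
(no support or size hypothesis) and every site `p` (`1 ≤ L`):
`cod (coProj L g) p = Σ_{c ∈ box} cod g (p + c)` if `p` is a base point (`L • blk L p = p`), and `0` otherwise.
Since `Π (grad f) = grad (f ∘ base)` (`AxialProjector.axProj_grad`: the projector kills the residual pure gauges and passes the
block-constant ones), its transpose `Πᵀ` sends the point divergence `dᵀ` to the BLOCK divergence read at the base point.  Proof:
truncate `g` to an2's block-closed neighbourhood `nbhd L p` (locality `coProj_congr_local`), pair against `grad δ_p`
(`sum_coProj_mul`), `axProj_grad`, summation by parts (`sum_mul_grad_eq`), `image_box_eq_filter`. -/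
theorem cod_coProj {L : ℕ} (hL : 1 ≤ L) (g : Form1 d ℝ) (p : Fin d → ℤ) :
    cod (coProj L g) p = if (L : ℤ) • blk L p = p then ∑ c ∈ box d L, cod g (p + toSite c) else 0 := by
  classical
  set U : Finset (Fin d → ℤ) := nbhd L p with hUdef
  have hU : BlockClosed L U := nbhd_blockClosed hL p
  have hL1 : (1 : ℤ) ≤ L := by exact_mod_cast hL
  -- the truncation of `g` to the bonds of `U` with heads in `U`
  set g' : Form1 d ℝ := fun κ z => if z ∈ U ∧ z + AffineAveraging.unitVec κ ∈ U then g κ z else 0 with hg'def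
  have hg' : ∀ (κ : Fin d) (z : Fin d → ℤ), g' κ z ≠ 0 → z ∈ U ∧ z + AffineAveraging.unitVec κ ∈ U := by
    intro κ z h
    by_contra hc
    exact h (by simp only [hg'def, if_neg hc])
  have hg'eq : ∀ (κ : Fin d) (z : Fin d → ℤ), z ∈ U ∧ z + AffineAveraging.unitVec κ ∈ U → g' κ z = g κ z := fun κ z h => by
    simp only [hg'def, if_pos h]
  -- membership of the sites we read
  have hpU : p ∈ U := mem_nbhd_of_le_succ hL fun i => by rw [sub_self, abs_zero]; positivity
  have hpeU : ∀ α : Fin d, p - AffineAveraging.unitVec α ∈ U := fun α => mem_nbhd_of_le_succ hL fun i => by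
    simp only [Pi.sub_apply, AffineAveraging.unitVec, Pi.single_apply]
    rw [abs_le]; split_ifs <;> constructor <;> omega
  -- (a) replace `g` by its truncation inside `cod (coProj L ·) p`
  have hloc : ∀ q : Fin d → ℤ, (∀ i, |q i - p i| ≤ 1) → ∀ α, coProj L g α q = coProj L g' α q := fun q hq α =>
    coProj_congr_local L fun κ z hz => (hg'eq κ z (near_mem_nbhd hL hq hz)).symm
  have ha : cod (coProj L g) p = cod (coProj L g') p := by
    simp only [cod]
    refine Finset.sum_congr rfl fun α _ => ?_
    rw [hloc p (fun i => by rw [sub_self, abs_zero]; exact zero_le_one) α,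
      hloc (p - AffineAveraging.unitVec α) (fun i => by
        simp only [Pi.sub_apply, AffineAveraging.unitVec, Pi.single_apply]
        split_ifs <;> simp) α]
  -- (b) `cod (Πᵀ g') p` as the pairing of `Πᵀ g'` against `grad δ_p` over `U`
  set δp : (Fin d → ℤ) → ℝ := fun x => if x = p then 1 else 0 with hδp
  have hb : cod (coProj L g') p = ∑ x ∈ U, ∑ α : Fin d, coProj L g' α x * grad δp α x := by
    rw [Finset.sum_comm]
    simp only [cod, grad]
    refine Finset.sum_congr rfl fun α _ => ?_
    simp only [mul_sub, Finset.sum_sub_distrib]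
    have e1 : ∑ x ∈ U, coProj L g' α x * δp (x + AffineAveraging.unitVec α) = coProj L g' α (p - AffineAveraging.unitVec α) := by
      have : ∀ x ∈ U, coProj L g' α x * δp (x + AffineAveraging.unitVec α)
          = if x = p - AffineAveraging.unitVec α then coProj L g' α x else 0 := by
        intro x _
        by_cases hx : x = p - AffineAveraging.unitVec α
        · rw [if_pos hx, hδp]; simp only [hx, sub_add_cancel, if_true, mul_one]
        · have hx' : x + AffineAveraging.unitVec α ≠ p := fun h => hx (by rw [← h, add_sub_cancel_right])
          rw [if_neg hx, hδp]; simp only [hx', if_false, mul_zero]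
      rw [Finset.sum_congr rfl this, Finset.sum_ite_eq' U, if_pos (hpeU α)]
    have e2 : ∑ x ∈ U, coProj L g' α x * δp x = coProj L g' α p := by
      have : ∀ x ∈ U, coProj L g' α x * δp x = if x = p then coProj L g' α x else 0 := by
        intro x _
        by_cases hx : x = p
        · rw [if_pos hx, hδp]; simp only [hx, if_true, mul_one]
        · rw [if_neg hx, hδp]; simp only [hx, if_false, mul_zero]
      rw [Finset.sum_congr rfl this, Finset.sum_ite_eq' U, if_pos hpU]
    rw [e1, e2]
  -- (c) adjunction + `Π (grad δ_p) = grad (δ_p ∘ base)` + summation by parts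
  have hc : ∑ x ∈ U, ∑ α : Fin d, coProj L g' α x * grad δp α x
      = ∑ q ∈ U, cod g' q * δp ((L : ℤ) • blk L q) := by
    rw [sum_coProj_mul hL hU g' (grad δp) hg', axProj_grad]
    exact sum_mul_grad_eq g' (fun x => δp ((L : ℤ) • blk L x)) hg'
  rw [ha, hb, hc]
  -- (d) evaluate the block indicator
  by_cases hp : (L : ℤ) • blk L p = p
  · rw [if_pos hp]
    have hind : ∀ q ∈ U, cod g' q * δp ((L : ℤ) • blk L q) = if blk L q = blk L p then cod g' q else 0 := by
      intro q _
      by_cases hq : blk L q = blk L p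
      · rw [if_pos hq, hδp]; simp only [hq, hp, if_true, mul_one]
      · have hq' : (L : ℤ) • blk L q ≠ p := fun h => hq (by rw [← blk_zsmul hL (blk L q), h])
        rw [if_neg hq, hδp]; simp only [hq', if_false, mul_zero]
    rw [Finset.sum_congr rfl hind, ← Finset.sum_filter, ← image_box_eq_filter hL hU hpU,
      Finset.sum_image (fun c _ c' _ h => toSite_injective (add_left_cancel h)), hp]
    refine Finset.sum_congr rfl fun c hc => ?_
    -- `cod g' = cod g` at the points of the block of `p`
    simp only [cod]
    refine Finset.sum_congr rfl fun κ _ => ?_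
    have hci : ∀ i, (0 : ℤ) ≤ toSite c i ∧ toSite c i ≤ (L : ℤ) - 1 := fun i => by
      have hc' := hc
      simp only [AffineAveraging.box, Fintype.mem_piFinset, Finset.mem_range] at hc'
      have := hc' i
      simp only [toSite]; constructor <;> omega
    have m1 : p + toSite c - AffineAveraging.unitVec κ ∈ U := mem_nbhd_of_le_succ hL fun i => by
      have := hci i
      simp only [Pi.sub_apply, Pi.add_apply, AffineAveraging.unitVec, Pi.single_apply]
      rw [abs_le]; split_ifs <;> constructor <;> omega
    have m3 : p + toSite c ∈ U := mem_nbhd_of_le_succ hL fun i => by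
      have := hci i
      simp only [Pi.add_apply]; rw [abs_le]; constructor <;> omega
    have m2 : p + toSite c - AffineAveraging.unitVec κ + AffineAveraging.unitVec κ ∈ U := by rw [sub_add_cancel]; exact m3
    have m4 : p + toSite c + AffineAveraging.unitVec κ ∈ U := mem_nbhd_of_le_succ hL fun i => by
      have := hci i
      simp only [Pi.add_apply, AffineAveraging.unitVec, Pi.single_apply]
      rw [abs_le]; split_ifs <;> constructor <;> omega
    rw [hg'eq κ _ ⟨m1, m2⟩, hg'eq κ _ ⟨m3, m4⟩]
  · rw [if_neg hp]
    refine Finset.sum_eq_zero fun q _ => ?_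
    have hq' : (L : ℤ) • blk L q ≠ p := fun h => hp (by rw [← h, blk_zsmul hL (blk L q)])
    rw [hδp]; simp only [hq', if_false, mul_zero]

/-- [folklore] The two unit-vector letters of the tree agree (`B6BondElimination.unitVec = AffineAveraging.unitVec = Pi.single · 1`). -/
theorem unitVec_eq (μ : Fin d) : (B6BondElimination.unitVec μ : Fin d → ℤ) = AffineAveraging.unitVec μ :=
  FineHessianWard.unitVec_eq_single μ

/-- [folklore] Evaluation at a kernel entry commutes with `Πᵀ` on `MKer`-valued bond families (any fibre; `AxialDressing.coProj_eval`
is the packed-fibre instance). -/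
theorem coProj_eval' {D : ℕ} {F : Type*} (N : ℕ) (S : Fin D → (Fin D → ℤ) → ExpKernelCalculus.MKer D F) (κ : Fin D)
    (u x y : Fin D → ℤ) (a b : F) : coProj N S κ u x y a b = coProj N (fun κ' u' => S κ' u' x y a b) κ u := by
  simp only [coProj_apply, AxialProjector.subtreeSum, cod, Pi.sub_apply, Finset.sum_apply]
  congr 1
  refine Finset.sum_congr rfl fun c _ => ?_
  split
  · simp only [Finset.sum_apply, Pi.sub_apply]
  · rfl

/-- [folklore] An entry of the pure-gauge vertex `KernelWard.divV V y` is the codifferential `cod` of the entry family. -/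
theorem divV_apply_eq_cod {D : ℕ} {F : Type*} (V : Fin D → (Fin D → ℤ) → ExpKernelCalculus.MKer D F) (y x z : Fin D → ℤ)
    (a b : F) : KernelWard.divV V y x z a b = cod (fun κ' u' => V κ' u' x z a b) y := by
  simp only [KernelWard.divV, cod, Finset.sum_apply, Pi.sub_apply, unitVec_eq]

/-- [folklore] **THE PURE-GAUGE VERTEX OF A `Πᵀ`-DRESSED STENCIL FAMILY** (`MKer` form of `cod_coProj`, any fibre, `1 ≤ N`): the fine
divergence `divV (coProj N S) u` VANISHES unless `u` is a base point, where it is the BLOCK SUM `Σ_{c ∈ box} divV S (u + c)` of the fine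
divergences of the undressed family — the dressed system answers only to block-constant gauge functions, and to those as the undressed
system does. -/
theorem divV_coProj {D : ℕ} {F : Type*} {N : ℕ} (hN : 1 ≤ N) (S : Fin D → (Fin D → ℤ) → ExpKernelCalculus.MKer D F)
    (u : Fin D → ℤ) :
    KernelWard.divV (coProj N S) u = if (N : ℤ) • blk N u = u then ∑ c ∈ box D N, KernelWard.divV S (u + toSite c) else 0 := by
  funext x z a b
  rw [divV_apply_eq_cod]
  have e2 : (fun κ' u' => coProj N S κ' u' x z a b) = coProj N (fun κ' u' => S κ' u' x z a b) := by
    funext κ' u'; exact coProj_eval' N S κ' u' x z a b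
  rw [e2, cod_coProj hN]
  split_ifs with h
  · simp only [Finset.sum_apply, divV_apply_eq_cod]
  · rfl

/-- [folklore] The pure-gauge slice `KernelWard.divW W u ν u′` of a bi-table is the pure-gauge vertex `divV` of its first-slot family. -/
theorem divW_eq_divV_fst {D : ℕ} {F : Type*} (W : Fin D → (Fin D → ℤ) → Fin D → (Fin D → ℤ) → ExpKernelCalculus.MKer D F)
    (u : Fin D → ℤ) (ν : Fin D) (u' : Fin D → ℤ) :
    KernelWard.divW W u ν u' = KernelWard.divV (fun κ x => W κ x ν u') u := rfl

/-- [folklore] **THE PURE-GAUGE SLICE OF A BI-TABLE DRESSED BY `Πᵀ` IN ITS FIRST BOND SLOT** (`1 ≤ N`, any fibre): for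
`W′ κ u ν u′ := coProj N (κ′ x ↦ Wf κ′ x ν u′) κ u`, `divW W′ u ν u′ = [N•blk N u = u] · Σ_{c ∈ box} divW Wf (u + c) ν u′` — the second-order
companion of `divV_coProj` (so a BLOCK second-order Ward law for `Wf` is the natural supplier of (W2♮) against a base-point-supported generator). -/
theorem divW_coProj_fst {D : ℕ} {F : Type*} {N : ℕ} (hN : 1 ≤ N)
    (Wf : Fin D → (Fin D → ℤ) → Fin D → (Fin D → ℤ) → ExpKernelCalculus.MKer D F) (u : Fin D → ℤ) (ν : Fin D) (u' : Fin D → ℤ) :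
    KernelWard.divW (fun κ x ν' x' => coProj N (fun κ' z => Wf κ' z ν' x') κ x) u ν u'
      = if (N : ℤ) • blk N u = u then ∑ c ∈ box D N, KernelWard.divW Wf (u + toSite c) ν u' else 0 := by
  rw [divW_eq_divV_fst]
  show KernelWard.divV (coProj N (fun κ' z => Wf κ' z ν u')) u = _
  rw [divV_coProj hN]
  split_ifs
  · rfl
  · rfl

end CodCoProj

end Summit.QuantumFields.BalabanUV.Beta.D1BFx.CoProjDivergence

end
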